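import Literature.IUT.LogVolume.Corollary22With
import Literature.IUT.LogVolume.Corollary22PartII
import HarnessLib

/-!
# [IUTchIV] Corollary 2.2 (ii) WITH AN EXPONENT `Λ ≥ 1` — PROVED as an assembly from the dilated interface
# `Thm110LegendreWith Λ` and the classical Galois-image input `FullGaloisImage`

Mochizuki, *Inter-universal Teichmüller theory IV*, RIMS manuscript (Apr. 2020; = PRIMS **57** (2021)),
Cor. 2.2 (ii), statement pp. 41–43, proof pp. 43–48. PROOF-ONLY companion of `Corollary22With.lean` and
`Λ`-port of the record `partII_of_thm110Legendre` (`Corollary22PartII.lean`): from `Cor22.Thm110LegendreWith Λ`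
(Thm. 1.10's display as applied on p. 46 l. 1 with its WHOLE right-hand side multiplied by `Λ ≥ 1` — a HYPOTHESIS
shape: at `Λ = 1` the record interface, which rests on [IUTchIII] Cor. 3.12; for `Λ > 1` what a conditional
"loss" line delivers) and `Cor22.FullGaloisImage` (the classical step (P4) ⇒ (P6), pp. 45–46; discharged in the
tree, a hypothesis here as in the record) we derive `Cor22.PartIIWith K_V (2^{140}·Λ⁵) Λ` for every `K_V` with the
hypotheses of Cor. 2.2 (`partIIWith_of_thm110LegendreWith`), hence `∃ H_unif, Corollary22With Λ H_unif`.

The printed proof is followed LINE BY LINE as in the record (prime `l` of (P1)–(P3); the exclusions absorbed into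
ONE exceptional set `Exc_d := {log(q^∀) ≤ 2^{140}·Λ⁵·ε_d^{−3}·d^{4+ε_d} + H_K}`, finite by Northcott through (i)),
and print's real arithmetic pp. 46–48 is REUSED VERBATIM through the record structure `Cor22.Data`
(`condition_C2`, `h_lt_of_one_lt_epsE`), instantiated at `δ := Λ·δ_d`, `L := Λ·(log(𝔡) + log(𝔣))`,
`η := Λ·η_prm`, `e*_mod := Λ·d*_mod` — every printed side condition of `Data` survives the dilation
(`arith_dilated`). The output is print's (C2) with `ε_E(Λδ) ≤ Λ³·ε_E(δ)` (`epsE_mul_le`) and the `Λ`-multiplied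
`L`, i.e. the conjunct (C2)_Λ `(1/6)·log(q^∀) ≤ Λ·(1 + Λ³·ε_E)·(log-diff + log-cond) + C_K` of
`ConditionsC1C2With` (`C_K := 40·Λ·η_prm + 2·B_K`); in the excluded case `ε_E(Λδ) > 1` print's bound reads
`h < (16/ε_d)³·(60Λδ)^{4+ε_d} ≤ Λ⁵·2^{137}·ε_d^{−3}·d^{4+ε_d}` (`epsE_exclusion_le_shape_with`), whence
`H_unif := 2^{140}·Λ⁵`. Why a factor of `Λ` INSIDE the `ε`-slot is unavoidable: module docstring of
`Corollary22With.lean`.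

TAKES NO SIDE on [IUTchIII] Cor. 3.12: the disputed material enters only through the hypothesis
`Thm110LegendreWith Λ`, by name; typed ≠ discharged; nothing here asserts that any display holds at any datum
or that abc (with any exponent) is proved or refuted. No new definitions.
-/

noncomputable section

namespace Literature.IUT.LogVolume

namespace Cor22

open NumberField IsDedekindDomain Real Polynomial Finset
open Literature.NumberTheory.DiophantineGeometry.GenEll

/-! ## Real arithmetic of the dilation `δ ↦ Λ·δ` -/

/-- `log(2δ·s²) ≥ 1` for `δ ≥ 2`, `s² ≥ 1` ("`log(2δ·h) ≥ log(2δ) ≥ log(4) ≥ 1`", p. 47).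
[claim: Mochizuki2012, status: disputed] -/
theorem one_le_log_two_mul_delta {δ s : ℝ} (hδ : 2 ≤ δ) (hs : 1 ≤ s ^ 2) :
    1 ≤ Real.log (2 * δ * s ^ 2) := by
  have h4 : (4 : ℝ) ≤ 2 * δ * s ^ 2 := by nlinarith
  have he : Real.exp 1 ≤ 4 := by
    have := Real.exp_one_lt_d9; linarith
  calc (1 : ℝ) = Real.log (Real.exp 1) := (Real.log_exp 1).symm
    _ ≤ Real.log 4 := Real.log_le_log (Real.exp_pos 1) he
    _ ≤ Real.log (2 * δ * s ^ 2) := Real.log_le_log (by norm_num) h4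

/-- (P1)'s upper bound `l ≤ 10δ·h^{1/2}·log(2δ·h)` is MONOTONE in `δ`: it persists with `δ ↦ Λδ`, `Λ ≥ 1`
(for `2δh ≥ 1`); print's (P1), p. 45, at the dilated `δ`. [claim: Mochizuki2012, status: disputed] -/
theorem P1hi_mono {l δ s Λ : ℝ} (hΛ : 1 ≤ Λ) (hδ : 0 < δ) (hs : 0 < s) (h1 : 1 ≤ 2 * δ * s ^ 2)
    (h : l ≤ 10 * δ * s * Real.log (2 * δ * s ^ 2)) :
    l ≤ 10 * (Λ * δ) * s * Real.log (2 * (Λ * δ) * s ^ 2) := by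
  have hlog0 : 0 ≤ Real.log (2 * δ * s ^ 2) := Real.log_nonneg h1
  have hlog : Real.log (2 * δ * s ^ 2) ≤ Real.log (2 * (Λ * δ) * s ^ 2) := by
    apply Real.log_le_log (by positivity)
    have : 2 * (Λ * δ) * s ^ 2 = Λ * (2 * δ * s ^ 2) := by ring
    rw [this]
    exact le_mul_of_one_le_left (by positivity) hΛ
  have hfac : 10 * δ * s ≤ 10 * (Λ * δ) * s := by
    have : 10 * (Λ * δ) * s = Λ * (10 * δ * s) := by ring
    rw [this]
    exact le_mul_of_one_le_left (by positivity) hΛ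
  exact h.trans (mul_le_mul hfac hlog hlog0 (by positivity))

/-- **The dilated `ε_E` costs at most `Λ³`**: `ε_E(Λδ) = (60Λδ)²·h^{−1/2}·log(2Λδ·h) ≤ Λ³·ε_E(δ)` for `Λ ≥ 1`
and `log(2δh) ≥ 1` (`log(2Λδh) = log Λ + log(2δh) ≤ (Λ − 1)·log(2δh) + log(2δh) = Λ·log(2δh)`); `ε_E` of p. 42/47.
[claim: Mochizuki2012, status: disputed] -/
theorem epsE_mul_le {δ s Λ : ℝ} (hΛ : 1 ≤ Λ) (hδ : 0 < δ) (hs : 0 < s)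
    (hlog : 1 ≤ Real.log (2 * δ * s ^ 2)) : epsE (Λ * δ) s ≤ Λ ^ 3 * epsE δ s := by
  unfold epsE
  have hΛ0 : 0 < Λ := lt_of_lt_of_le one_pos hΛ
  have hx0 : 0 < 2 * δ * s ^ 2 := by positivity
  have hsplit : Real.log (2 * (Λ * δ) * s ^ 2) = Real.log Λ + Real.log (2 * δ * s ^ 2) := by
    have : 2 * (Λ * δ) * s ^ 2 = Λ * (2 * δ * s ^ 2) := by ring
    rw [this, Real.log_mul hΛ0.ne' hx0.ne']
  have hlogΛ : Real.log Λ ≤ Λ - 1 := Real.log_le_sub_one_of_pos hΛ0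
  have hle : Real.log (2 * (Λ * δ) * s ^ 2) ≤ Λ * Real.log (2 * δ * s ^ 2) := by
    rw [hsplit]
    nlinarith
  have hc : 0 ≤ (60 * (Λ * δ)) ^ 2 / s := by positivity
  calc (60 * (Λ * δ)) ^ 2 / s * Real.log (2 * (Λ * δ) * s ^ 2)
      ≤ (60 * (Λ * δ)) ^ 2 / s * (Λ * Real.log (2 * δ * s ^ 2)) := mul_le_mul_of_nonneg_left hle hc
    _ = Λ ^ 3 * ((60 * δ) ^ 2 / s * Real.log (2 * δ * s ^ 2)) := by ring

/-- The `ε_E > 1` exclusion constant at the dilated `δ` fits the printed shape with the factor `Λ⁵`: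
`(16/ε_d)³·(60Λδ)^{4+ε_d} ≤ Λ⁵·2^{137}·ε_d^{−3}·d^{4+ε_d}` (`Λ^{4+ε_d} ≤ Λ⁵`; `epsE_exclusion_le_shape`, p. 47). [claim: Mochizuki2012, status: disputed] -/
theorem epsE_exclusion_le_shape_with {d : ℕ} (hd : 1 ≤ d) {ε : ℝ} (hε0 : 0 < ε) (hε1 : ε ≤ 1) {Λ : ℝ}
    (hΛ : 1 ≤ Λ) :
    (16 / ε) ^ (3 : ℝ) * (60 * (Λ * delta d)) ^ (4 + ε) ≤
      Λ ^ 5 * (2 ^ 137 * (ε ^ (-(3 : ℝ)) * (d : ℝ) ^ (4 + ε))) := by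
  have hΛ0 : 0 ≤ Λ := zero_le_one.trans hΛ
  have hδ0 : 0 ≤ 60 * delta d := by unfold delta; positivity
  have hsplit : (60 * (Λ * delta d)) ^ (4 + ε) = Λ ^ (4 + ε) * (60 * delta d) ^ (4 + ε) := by
    rw [show 60 * (Λ * delta d) = Λ * (60 * delta d) by ring]
    exact Real.mul_rpow hΛ0 hδ0
  have hΛ5 : Λ ^ (4 + ε) ≤ Λ ^ 5 := by
    calc Λ ^ (4 + ε) ≤ Λ ^ ((5 : ℕ) : ℝ) := Real.rpow_le_rpow_of_exponent_le hΛ (by push_cast; linarith)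
      _ = Λ ^ 5 := Real.rpow_natCast Λ 5
  have hrec := epsE_exclusion_le_shape hd hε0 hε1
  have h16 : 0 ≤ (16 / ε) ^ (3 : ℝ) := Real.rpow_nonneg (by positivity) _
  have h60 : 0 ≤ (60 * delta d) ^ (4 + ε) := Real.rpow_nonneg hδ0 _
  have hX : 0 ≤ 2 ^ 137 * (ε ^ (-(3 : ℝ)) * (d : ℝ) ^ (4 + ε)) := by
    have := Real.rpow_nonneg hε0.le (-(3 : ℝ))
    have := Real.rpow_nonneg (Nat.cast_nonneg d) (4 + ε)
    positivity
  rw [hsplit]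
  calc (16 / ε) ^ (3 : ℝ) * (Λ ^ (4 + ε) * (60 * delta d) ^ (4 + ε))
      = Λ ^ (4 + ε) * ((16 / ε) ^ (3 : ℝ) * (60 * delta d) ^ (4 + ε)) := by ring
    _ ≤ Λ ^ 5 * (2 ^ 137 * (ε ^ (-(3 : ℝ)) * (d : ℝ) ^ (4 + ε))) :=
        mul_le_mul hΛ5 hrec (mul_nonneg h16 h60) (by positivity)

/-- `ε_d^{−3} ≥ 1` for `0 < ε_d ≤ 1`. [folklore] -/
private theorem one_le_rpow_neg_three' {ε : ℝ} (hε0 : 0 < ε) (hε1 : ε ≤ 1) : 1 ≤ ε ^ (-(3 : ℝ)) := by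
  rw [Real.rpow_neg hε0.le]
  exact (one_le_inv₀ (Real.rpow_pos_of_pos hε0 _)).mpr (Real.rpow_le_one hε0.le hε1 (by norm_num))

/-- `d² ≤ d^{4+ε_d}` for `d ≥ 1`, `ε_d > 0`. [folklore] -/
private theorem natCast_sq_le_rpow' {d : ℕ} (hd : 1 ≤ d) {ε : ℝ} (hε0 : 0 < ε) :
    (d : ℝ) ^ 2 ≤ (d : ℝ) ^ (4 + ε) := by
  have hd1 : (1 : ℝ) ≤ d := by exact_mod_cast hd
  calc (d : ℝ) ^ 2 = (d : ℝ) ^ ((2 : ℕ) : ℝ) := (Real.rpow_natCast _ 2).symm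
    _ ≤ (d : ℝ) ^ (4 + ε) := Real.rpow_le_rpow_of_exponent_le hd1 (by push_cast; linarith)

/-- The (P5)-exclusion constant fits the printed shape: `81·δ² ≤ 2^{45}·ε_d^{−3}·d^{4+ε_d}`. [folklore] -/
private theorem delta_sq_le_shape' {d : ℕ} (hd : 1 ≤ d) {ε : ℝ} (hε0 : 0 < ε) (hε1 : ε ≤ 1) :
    81 * delta d ^ 2 ≤ 2 ^ 45 * (ε ^ (-(3 : ℝ)) * (d : ℝ) ^ (4 + ε)) := by
  unfold delta
  have h1 := one_le_rpow_neg_three' hε0 hε1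
  have h2 := natCast_sq_le_rpow' hd hε0
  have hd0 : (0 : ℝ) ≤ (d : ℝ) ^ 2 := sq_nonneg _
  have h3 : 1 * (d : ℝ) ^ 2 ≤ ε ^ (-(3 : ℝ)) * (d : ℝ) ^ (4 + ε) :=
    mul_le_mul h1 h2 hd0 (le_trans zero_le_one h1)
  calc 81 * (2 ^ 12 * 3 ^ 3 * 5 * (d : ℝ)) ^ 2 = (81 * 552960 ^ 2) * (1 * (d : ℝ) ^ 2) := by ring
    _ ≤ 2 ^ 45 * (1 * (d : ℝ) ^ 2) := by nlinarith
    _ ≤ 2 ^ 45 * (ε ^ (-(3 : ℝ)) * (d : ℝ) ^ (4 + ε)) := by nlinarith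

/-! ## Print's arithmetic (pp. 46–48) run at `δ ↦ Λ·δ`, packaged -/

/-- **Print's arithmetic of the proof of Cor. 2.2 (ii) (pp. 46–48; the record `Cor22.Data`) RUN AT `δ ↦ Λδ`,
`L ↦ ΛL`, `η_prm ↦ Λη_prm`, `e*_mod ↦ Λ·d*_mod`**, for one curve: from `h^{1/2} = s ≥ 5`, `δ ≥ 2`, (P1)
`s ≤ l ≤ 10δ·s·log(2δ·s²)`, `L_𝔡, L_𝔣 ≥ 0` with `L_𝔣 ≤ log-cond`, `η_prm > 0`, `B_K ≥ 0`, `0 ≤ d_mod`, `20·d_mod ≤ δ`,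
`d*_mod ≤ δ`, the DILATED display `(1/6)·log(q) ≤ Λ·((1 + 20·d_mod/l)·(L_𝔡 + L_𝔣) + 20·(d*_mod·l + η_prm))`, and print's
`Q1`, `Q2`, `log(q) ≤ log(q^{∤2}) ≤ h`: EITHER `ε_E(Λδ) ≤ 1` and then (C2) at `δ ↦ Λδ` —
`(1/6)·log(q) ≤ (1/6)·log(q^{∤2}) ≤ (1/6)·h ≤ (1 + ε_E(Λδ))·(Λ·L_𝔡 + Λ·log-cond) + C_K(Λη_prm, B_K)` (`Data.condition_C2`) —
OR `ε_E(Λδ) > 1` and then `h < (16/ε_d)³·(60Λδ)^{4+ε_d}` for every `0 < ε_d ≤ 1` (`Data.h_lt_of_one_lt_epsE`). Every field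
of `Cor22.Data` is checked to survive the dilation (`P1hi_mono`; `20·d_mod ≤ δ ≤ Λδ`; `Λ·d*_mod ≤ Λδ`); nothing of the
record arithmetic is re-proved. [claim: Mochizuki2012, status: disputed] -/
theorem arith_dilated {Λ s δ l Ld Lc Lcond η B logq logq2 dm : ℝ} (hΛ : 1 ≤ Λ) (h5s : 5 ≤ s) (hδ2 : 2 ≤ δ)
    (hP1lo : s ≤ l) (hP1hi : l ≤ 10 * δ * s * Real.log (2 * δ * s ^ 2)) (hLd : 0 ≤ Ld) (hLc : 0 ≤ Lc)
    (hLcond : Lc ≤ Lcond) (hη : 0 < η) (hB : 0 ≤ B) (hdm : 0 ≤ dm) (h20 : 20 * dm ≤ δ)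
    (hdstar : 2 ^ 12 * 3 ^ 3 * 5 * dm ≤ δ)
    (hdisp : 1 / 6 * logq ≤ Λ * ((1 + 20 * dm / l) * (Ld + Lc) + 20 * (2 ^ 12 * 3 ^ 3 * 5 * dm * l + η)))
    (hQ1 : 1 / 6 * logq2 - 1 / 6 * logq ≤ 1 / 6 * s * Real.log l) (hQ2 : 1 / 6 * s ^ 2 - 1 / 6 * logq2 ≤ B)
    (hq1 : logq ≤ logq2) (hq2 : logq2 ≤ s ^ 2) :
    (epsE (Λ * δ) s ≤ 1 →
      1 / 6 * logq ≤ 1 / 6 * logq2 ∧ 1 / 6 * logq2 ≤ 1 / 6 * s ^ 2 ∧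
        1 / 6 * s ^ 2 ≤ (1 + epsE (Λ * δ) s) * (Λ * Ld + Λ * Lcond) + CK (Λ * η) B) ∧
    (1 < epsE (Λ * δ) s → ∀ εd : ℝ, 0 < εd → εd ≤ 1 →
      s ^ 2 < (16 / εd) ^ (3 : ℝ) * (60 * (Λ * δ)) ^ (4 + εd)) := by
  have hΛ0 : 0 < Λ := lt_of_lt_of_le one_pos hΛ
  have hs0 : 0 < s := by linarith
  have hδ0 : 0 < δ := by linarith
  have h1s : 1 ≤ s ^ 2 := by nlinarith
  have h2δs : 1 ≤ 2 * δ * s ^ 2 := by nlinarith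
  have hdst0 : 0 ≤ 2 ^ 12 * 3 ^ 3 * 5 * dm := by positivity
  let A : Data :=
    { s := s, five_le_s := h5s, δ := Λ * δ,
      two_le_δ := le_trans hδ2 (le_mul_of_one_le_left hδ0.le hΛ), l := l, P1lo := hP1lo,
      P1hi := P1hi_mono hΛ hδ0 hs0 h2δs hP1hi,
      L := Λ * (Ld + Lc), L_nonneg := mul_nonneg hΛ0.le (add_nonneg hLd hLc),
      η := Λ * η, η_nonneg := (mul_pos hΛ0 hη).le, B := B, B_nonneg := hB,
      logq := logq, logq2 := logq2,
      dmod := dm, dmod_nonneg := hdm, twenty_dmod_le := h20.trans (le_mul_of_one_le_left hδ0.le hΛ),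
      estar := Λ * (2 ^ 12 * 3 ^ 3 * 5 * dm), estar_nonneg := mul_nonneg hΛ0.le hdst0,
      estar_le := mul_le_mul_of_nonneg_left hdstar hΛ0.le,
      disp := by
        calc 1 / 6 * logq
            ≤ Λ * ((1 + 20 * dm / l) * (Ld + Lc) + 20 * (2 ^ 12 * 3 ^ 3 * 5 * dm * l + η)) := hdisp
          _ = (1 + 20 * dm / l) * (Λ * (Ld + Lc)) + 20 * (Λ * (2 ^ 12 * 3 ^ 3 * 5 * dm) * l + Λ * η) := by
              ring,
      Q1 := hQ1, Q2 := hQ2 }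
  refine ⟨fun hε => ?_, fun hε εd h0 h1 => A.h_lt_of_one_lt_epsE hε h0 h1⟩
  exact A.condition_C2 hε (logDiffTpd := Λ * Ld) (logCondTpd := Λ * Lc)
    (show Λ * (Ld + Lc) = Λ * Ld + Λ * Lc by ring) rfl (mul_le_mul_of_nonneg_left hLcond hΛ0.le) hq1 hq2

/-! ## The assembly -/

/-- **[IUTchIV] Corollary 2.2 (ii) WITH THE EXPONENT `Λ ≥ 1`, PROVED from the dilated interface and the classical
Galois-image input** for the compactly bounded subset `K_V` (support `∋ 2`, (∗^{j-inv})) and any `η_prm` of Prop. 1.6,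
with `H_unif := 2^{140}·Λ⁵`, `C_K := 40·Λ·η_prm + 2·B_K`: the statement `Cor22.PartIIWith K_V (2^{140}·Λ⁵) Λ` — print's
(ii) (pp. 41–43) with (C2) replaced by (C2)_Λ `(1/6)·log(q) ≤ (1/6)·log(q^{∤2}) ≤ (1/6)·log(q^∀) ≤
Λ·(1 + Λ³·ε_E)·(log-diff_X(x_E) + log-cond_D(x_E)) + C_K`. The proof is the printed one (pp. 43–48) with print's
arithmetic `Cor22.Data` run at `δ ↦ Λδ` (module docstring); the disputed Theorem 1.10 — dilated — enters only through
`h110`. At `Λ = 1` this is `partII_of_thm110Legendre` (same constants). [claim: Mochizuki2012, status: disputed] -/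
theorem partIIWith_of_thm110LegendreWith {Λ : ℝ} (hΛ : 1 ≤ Λ) (h110 : Thm110LegendreWith Λ)
    (hFG : FullGaloisImage) {η : ℝ} (hη : IsEtaPrm η) (D : CBData) (hD : Hypotheses D) :
    PartIIWith D (2 ^ 140 * Λ ^ 5) Λ := by
  classical
  have hΛ0 : 0 < Λ := lt_of_lt_of_le one_pos hΛ
  have hΛ5 : 1 ≤ Λ ^ 5 := one_le_pow₀ hΛ
  -- the constants delivered by Cor. 2.2 (i): `B_K` (p. 47) and the height comparison for Northcott
  obtain ⟨h12, h23, h3⟩ := partI_holds D hD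
  obtain ⟨B₀, hB₀⟩ := bdEquiv_iff_abs.mp h12
  set B₁ : ℝ := max B₀ 0 with hB₁def
  have hB₁0 : 0 ≤ B₁ := le_max_right _ _
  have hB₁ : ∀ P ∈ D.toSet, |1 / 6 * logQNotTwo P - 1 / 6 * logQForall P| ≤ B₁ := fun P hP => by
    have hx : |1 / 6 * logQNotTwo P - 1 / 6 * logQForall P| ≤ B₀ := hB₀ P hP
    exact hx.trans (le_max_left _ _)
  obtain ⟨C₀, hC₀⟩ := (h3.symm.trans h23.symm).bdLe
  -- the `H_K` of the classical Galois-image input (the (P4) step, pp. 45–46); `ξ_prm`; `η_prm > 0`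
  obtain ⟨G₀, hG₀⟩ := hFG D hD
  set G : ℝ := max G₀ 0 with hGdef
  have hG0 : 0 ≤ G := le_max_right _ _
  obtain ⟨ξ, hξ⟩ := exists_isXiPrm
  have hξ5 : 5 ≤ ξ := hξ.1
  have hη0 : 0 < η := hη.1
  -- `C_K := 40·Λ·η_prm + 2·B_K`, `H_K`
  set HK : ℝ := ξ ^ 2 + 12 * B₁ + G + 13 with hHKdef
  have hHK0 : 0 < HK := by positivity
  refine ⟨CK (Λ * η) B₁, HK, by unfold CK; positivity, hHK0, ?_⟩
  intro d hd εd hεd0 hεd1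
  -- the exceptional set
  set X : ℝ := εd ^ (-(3 : ℝ)) * (d : ℝ) ^ (4 + εd) with hXdef
  have hX0 : 0 ≤ X := mul_nonneg (Real.rpow_nonneg hεd0.le _) (Real.rpow_nonneg (Nat.cast_nonneg _) _)
  set Bd : ℝ := 2 ^ 140 * Λ ^ 5 * X + HK with hBddef
  have hBdX : 0 ≤ 2 ^ 140 * X := by positivity
  have hBdX' : 2 ^ 140 * X ≤ 2 ^ 140 * Λ ^ 5 * X := by
    have := mul_le_mul_of_nonneg_left hΛ5 hBdX
    nlinarith
  have hBd0 : 0 ≤ Bd := by positivity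
  have hξ2 : (25 : ℝ) ≤ ξ ^ 2 := by nlinarith
  have hBd1 : ξ ^ 2 ≤ Bd := by linarith
  have hBd2 : G < Bd := by linarith
  have hBd3 : 12 * B₁ + 81 * delta d ^ 2 ≤ Bd := by
    have := delta_sq_le_shape' hd hεd0 hεd1
    nlinarith
  have hBd4 : (16 / εd) ^ (3 : ℝ) * (60 * (Λ * delta d)) ^ (4 + εd) ≤ Bd := by
    have := epsE_exclusion_le_shape_with hd hεd0 hεd1 hΛ
    nlinarith
  have hBd5 : 12 ≤ Bd := by linarith
  have hX1 : 1 ≤ X := by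
    have h1 := one_le_rpow_neg_three' hεd0 hεd1
    have h2 : (1 : ℝ) ≤ (d : ℝ) ^ (4 + εd) :=
      Real.one_le_rpow (by exact_mod_cast hd) (by linarith)
    nlinarith
  have hBd6 : 49 < Bd := by nlinarith
  refine ⟨{P | P ∈ D.toSet ∩ UPle d ∧ logQForall P ≤ Bd}, ?_, ?_, ?_, ?_, ?_⟩
  · -- finiteness: Northcott ([GenEll] Prop. 1.4 (iv)) through (i) `ht ≤ (1/6)·log(q^∀) + C₀` on `K_V`
    refine (northcott_UPle_holds d (1 / 6 * Bd + C₀)).mono ?_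
    rintro P ⟨⟨hPD, hPd⟩, hPB⟩
    refine ⟨hPd, ?_⟩
    have hx : NFPoint.ht P - 1 / 6 * logQForall P ≤ C₀ := hC₀ P hPD
    linarith
  · rintro P ⟨⟨_, hPd⟩, _⟩; exact hPd
  · -- `j ∈ {0, 1728}`: `log(q^∀) = 0`
    rintro P hP hj
    exact ⟨hP, by rw [logQForall_eq_zero_of_jInv_zero_or_1728 hj]; exact hBd0⟩
  · rintro P ⟨_, hPB⟩
    show logQForall P ≤ 2 ^ 140 * Λ ^ 5 * εd ^ (-(3 : ℝ)) * (d : ℝ) ^ (4 + εd) + HK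
    have e : 2 ^ 140 * Λ ^ 5 * εd ^ (-(3 : ℝ)) * (d : ℝ) ^ (4 + εd) = 2 ^ 140 * Λ ^ 5 * X := by
      rw [hXdef]; ring
    rw [e]; exact hPB
  -- the main case: `x_E ∈ K_V ∩ U_X(ℚ̄)^{≤d}`, `x_E ∉ Exc_d`
  rintro P ⟨hPD, hPd⟩ hPexc
  have hPU : P ∈ UP := hPd.1
  have hPdeg : P.degree ≤ d := hPd.2
  have hInU : P.InU := hPU.1
  set h : ℝ := logQForall P with hhdef
  have hgt : Bd < h := by
    by_contra hle
    exact hPexc ⟨⟨hPD, hPd⟩, not_lt.mp hle⟩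
  have hh0 : 0 ≤ h := logQAvoid_nonneg P ∅
  set s : ℝ := Real.sqrt h with hsdef
  have hs2 : s ^ 2 = h := Real.sq_sqrt hh0
  have hξs : ξ ≤ s := by
    have h1 : Real.sqrt (ξ ^ 2) ≤ Real.sqrt h := Real.sqrt_le_sqrt (by linarith)
    rwa [Real.sqrt_sq (by linarith)] at h1
  have h5s : 5 ≤ s := le_trans hξ5 hξs
  have hs0 : 0 < s := by linarith
  have hδ2 := two_le_delta hd
  have hδ := delta_ge hd
  have hδ0 : 0 < delta d := by linarith
  have hdδ : (P.degree : ℝ) ≤ delta d := by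
    have : (P.degree : ℝ) ≤ d := by exact_mod_cast hPdeg
    unfold delta; nlinarith
  have h1s : 1 ≤ s ^ 2 := by nlinarith
  have hlog1 : 1 ≤ Real.log (2 * delta d * s ^ 2) := one_le_log_two_mul_delta hδ2 h1s
  -- the curves without `F`-core are in `Exc_d` (p. 43): `log(q^∀) ≤ 12 ≤ B_d` there
  have hcore : AdmitsCore P := by
    by_contra hno
    have := logQForall_le_of_not_admitsCore hno
    linarith
  -- the prime `l` of (P1), (P2), (P3) (pp. 44–45)
  have hprime : ∃ l : ℕ, l.Prime ∧ Real.sqrt h ≤ l ∧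
      (l : ℝ) ≤ 10 * delta d * Real.sqrt h * Real.log (2 * delta d * h) ∧
      (∀ v ∈ badPlaces P, (-(ord P.F v (jInv P.x))).toNat ≠ 0 → ¬ l ∣ (-(ord P.F v (jInv P.x))).toNat) ∧
      (∀ v ∈ badPlaces P, residueChar P.F v = l →
        (((-(ord P.F v (jInv P.x))).toNat : ℕ) : ℝ) < Real.sqrt h) :=
    PrimeChoiceData.exists_prime_P1_P2_P3
      { ι := HeightOneSpectrum (𝓞 P.F), instDecEq := inferInstance, V := badPlaces P,
        hv := fun v => (-(ord P.F v (jInv P.x))).toNat, fv := resDeg P.F,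
        one_le_fv := fun v _ => Nat.one_le_iff_ne_zero.mpr (resDeg_ne_zero P.F v),
        pv := residueChar P.F, pv_prime := fun v _ => residueChar_prime P.F v,
        d := P.degree, one_le_d := P.degree_pos, δ := delta d, two_le_δ := hδ2, d_le_δ := hdδ,
        h := h, h_def := degree_mul_logQForall_eq_sum P, ξ := ξ, isXiPrm := hξ, ξ_le_sqrt := hξs }
  obtain ⟨l, hlp, hP1lo, hP1hi, hP2, hP3⟩ := hprime
  haveI : Fact l.Prime := ⟨hlp⟩
  -- `l ≥ h^{1/2} > 7`
  have h7s : 7 < s := by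
    rw [hsdef, Real.lt_sqrt (by norm_num)]
    linarith
  have h7l : 7 ≤ l := by
    have : (7 : ℝ) ≤ l := le_trans h7s.le hP1lo
    exact_mod_cast this
  have h5l : 5 ≤ l := le_trans (by norm_num) h7l
  have hl5 : (5 : ℝ) ≤ l := by exact_mod_cast h5l
  have hP2' : CondP2 P l := condP2_of_toNat hP2
  -- consequences of (P3) and (i) (p. 47): `log(q^{∤2}) − log(q) ≤ h^{1/2}·log(l)`, `h − log(q^{∤2}) ≤ 6·B_K`
  have hQ1 : logQNotTwo P - logQAvoid P {2, l} ≤ s * Real.log l := by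
    have := logQAvoid_sub_insert_le P {2} hlp (Real.sqrt_nonneg h) (fun v hv hlv =>
      (hP3 v hv ((mem_placesOver_iff_residueChar v).mp (mem_placesOver_of_natCast_mem l v hlv))).le)
    rwa [Finset.pair_comm] at this
  have hQ2 : h - logQNotTwo P ≤ 6 * B₁ := by
    have := (abs_le.mp (hB₁ P hPD)).1
    linarith
  have hq12 : logQAvoid P {2, l} ≤ logQNotTwo P :=
    logQAvoid_anti P (Finset.singleton_subset_iff.mpr (Finset.mem_insert_self 2 {l}))
  have hq2h : logQNotTwo P ≤ h := logQAvoid_anti P (Finset.empty_subset _)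
  -- (P5): `𝕍^bad_mod ≠ ∅` (else `h ≤ 12·B_K + 81·δ² ≤ B_d < h`)
  have hP5 : CondP5 P l := by
    by_contra hno
    have hq0 := logQAvoid_pair_eq_zero_of_not_condP5 hno
    have hL : (l : ℝ) ≤ 20 * delta d ^ 2 * s ^ 4 := l_le_of_P1 h5s hδ2 (by rw [hs2]; exact hP1hi)
    have hmain : s ^ 2 ≤ 6 * B₁ + s * Real.log l := by rw [hs2]; linarith
    have := h_le_of_no_bad h5s hδ hB₁0 hl5 hL hmain
    rw [hs2] at this
    linarith
  -- (P4) ⇒ (P6): the classical Galois-image input (pp. 45–46), applicable since `h > H_K ≥ G₀`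
  have hP6 : CondP6 P l := hG₀ P hPD hPU l hlp (by omega) hP2' hP5 (by linarith [le_max_left G₀ 0])
  -- (P7) + Theorem 1.10 DILATED (p. 46): the HYPOTHESIS
  have hdisp : DisplayWith P l η Λ := h110 η hη P hPU l hlp (by omega) hcore hP2' hP5 hP6
  -- print's arithmetic pp. 46–48 (`Corollary22Arithmetic.lean`) run at `δ ↦ Λδ`, `L ↦ ΛL`, `η ↦ Λη`,
  -- `e* ↦ Λ·d*_mod` (`arith_dilated`), with `d*_mod` in the rôle of `e*_mod`
  have harith := arith_dilated hΛ h5s hδ2 hP1lo (by rw [hs2]; exact hP1hi) P.logDiff_nonneg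
    (logCondAvoid_nonneg P {2, l}) (logCondAvoid_le_logCond P hInU {2, l}) hη0 hB₁0
    (Nat.cast_nonneg (dmod P)) (twenty_dmod_le P hPdeg) (dstar_le_delta P hPdeg)
    (by have hd' := hdisp; unfold DisplayWith at hd'; exact hd')
    (by linarith) (by rw [hs2]; linarith) hq12 (by rw [hs2]; exact hq2h)
  obtain ⟨hmainC2, hexcl⟩ := harith
  by_cases hε : epsE (Λ * delta d) s ≤ 1
  · obtain ⟨c1, c2, c3⟩ := hmainC2 hε
    -- `ε_E(Λδ) ≤ Λ³·ε_E(δ) = Λ³·epsilonE d P`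
    have heps : epsilonE d P = epsE (delta d) s := by
      unfold epsilonE epsE
      rw [← hhdef, ← hsdef, hs2]
      ring
    have hε3 : epsE (Λ * delta d) s ≤ Λ ^ 3 * epsilonE d P := by
      rw [heps]; exact epsE_mul_le hΛ hδ0 hs0 hlog1
    have hLC : 0 ≤ P.logDiff + P.logCond := add_nonneg P.logDiff_nonneg P.logCond_nonneg
    have hmono : (1 + epsE (Λ * delta d) s) * (Λ * P.logDiff + Λ * P.logCond) ≤
        Λ * ((1 + Λ ^ 3 * epsilonE d P) * (P.logDiff + P.logCond)) := by
      have e : (1 + epsE (Λ * delta d) s) * (Λ * P.logDiff + Λ * P.logCond) =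
          Λ * ((1 + epsE (Λ * delta d) s) * (P.logDiff + P.logCond)) := by ring
      rw [e]
      exact mul_le_mul_of_nonneg_left (mul_le_mul_of_nonneg_right (by linarith) hLC) hΛ0.le
    refine ⟨l, hlp, h5l, hP1lo, hP1hi, c1, ?_, ?_⟩
    · rw [hs2] at c2; exact c2
    · rw [← hhdef, ← hs2]
      linarith
  · -- `ε_E(Λδ) > 1`: excluded (p. 47 at `δ ↦ Λδ`), `h < (16/ε_d)³·(60Λδ)^{4+ε_d} ≤ B_d < h`
    exfalso
    rw [not_le] at hε
    have hlt : s ^ 2 < (16 / εd) ^ (3 : ℝ) * (60 * (Λ * delta d)) ^ (4 + εd) := hexcl hε εd hεd0 hεd1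
    rw [hs2] at hlt
    linarith

/-- **[IUTchIV] Corollary 2.2 with the exponent `Λ ≥ 1` from the dilated interface and the classical
Galois-image input**: (i) and (iii) are PROVED in the tree unconditionally (`partI_holds`,
`exists_threshold_partIII_of_partI`, assembled by `exists_corollary22With_of_partIIWith`), (ii)_Λ by
`partIIWith_of_thm110LegendreWith`. The dilated Theorem 1.10 enters only through `Thm110LegendreWith Λ`.
[claim: Mochizuki2012, status: disputed] -/
theorem exists_corollary22With_of_thm110LegendreWith {Λ : ℝ} (hΛ : 1 ≤ Λ) (h110 : Thm110LegendreWith Λ)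
    (hFG : FullGaloisImage) : ∃ Hunif : ℝ, Corollary22With Λ Hunif := by
  obtain ⟨η, hη⟩ := exists_isEtaPrm
  exact exists_corollary22With_of_partIIWith fun D hD => partIIWith_of_thm110LegendreWith hΛ h110 hFG hη D hD

end Cor22

end Literature.IUT.LogVolume

end
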